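import Summits.QuantumFields.YangMills.Theorems.BalabanLadderNTBoundaryLawStrongCoupling
import HarnessLib

/-!
# Seam `UVSeamRec` (stmt-QuantumFields-20043), stub `stub_ceilings : UV → MomentBounds6 SU(2) rF uRec`: the collar OUTPUT
# `(C/R⁴)ⁿ` holds at STRONG COUPLING for every compact `G` — format rung of the ceilings' conclusion

Helper file of the fleet lead prover of crux `NT` (unit `ym-spine-19353-p1`, g6), filed under the seam item (owner R78).  The
registered ceilings stub of `UVSeamRec` (skeleton v4-F) concludes `MomentBounds6 SU(2) rF uRec`: on every odd torus, for every
string of single-plane fields `plane (qᵢ) (xᵢ)` at sites pairwise `≥ 2R + 4` apart (torus sup-distance), the centred mixed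
moment is `≤ (C/R⁴)ⁿ` — for `β ≥ β₄` and `R · uRec β ≤ ℓ₄`.  Its discharge of record runs the landed collar transfer
`stub_collar6 : FBL6 → MomentBounds6` on the ∀-exterior plane-resolved one-point law `FBL6` (⇔ E1-osc), the open engine content
at large `β`.  This file proves the BODY of that conclusion at strong coupling, for EVERY compact metrisable `G`, every lattice
representation, every odd torus, WITHOUT femto restriction:

* `centredMoments6_le_smallBeta_exp` — there is `β₁ = β₁(G, r) > 0` such that for `|β| < β₁`, every `L, n`, orientations
  `q`, sites `x` with the registered separation clause, and every `R ≥ 1` with `4R + 8 ≤ L`: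
  `|torusE_L[∏ᵢ (plane (qᵢ) (xᵢ) − torusE_L(plane (qᵢ) (xᵢ)))]| ≤ (2592 M₆ · 2^{−R})ⁿ` (`M₆` = sup of the plaquette fields) — the
  torus DLR step of `stub_collar6` (tree `abs_integral_prod_sub_mean_le`, one radius-`R+1` cube per site, conditional
  independence of the frozen cubes) fed with the strong-coupling one-point oscillation `BoundaryLaw.osc_kerE_plane_le_smallBeta`
  (reference value = the kernel mean under ONE fixed exterior, error = the oscillation `5184 M₆ 2^{−(R+2)}`);
* `centredMoments6_le_smallBeta` — the REGISTERED shape `(C/R⁴)ⁿ` with `C = 62208 M₆ / (log 2)⁴`.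

HONEST FRAMING.  A format rung: the `(C/R⁴)ⁿ` ceiling shape of `MomentBounds6` is inhabited by Wilson's lattice Yang–Mills
measure on every odd torus in the high-temperature regime; nothing about `UV`, Bałaban's unit, `β → ∞`, the seam or the gap.
-/

set_option autoImplicit false

noncomputable section

open MeasureTheory Filter Topology
open Literature.MathematicalPhysics.QuantumFieldTheory Literature.MathematicalPhysics.QuantumLattice
open Literature.Probability.LatticeModels
open Summit.QuantumFields.YangMills.Cruxes.OSLegsFromFemtoAndGap.DlrCollarTransfer

namespace Summit.QuantumFields.YangMills.Cruxes.NT.StrongCoupling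

section Main

variable (G : Type) [Group G] [TopologicalSpace G] [IsTopologicalGroup G] [CompactSpace G]
  [MeasurableSpace G] [BorelSpace G] (r : LatticeRep G)

/-- **Centred mixed moments of plane-field strings at strong coupling, exponential form.**  There is `β₁ = β₁(G, r) > 0` such
that for `|β| < β₁`, every odd torus `2L+1`, every string of orientations `q` and sites `x` pairwise `≥ 2R+4` apart in torus
sup-distance (`1 ≤ R`, `4R + 8 ≤ L`):
`|torusE_L[∏ᵢ (plane (qᵢ)(xᵢ) − torusE_L(plane (qᵢ)(xᵢ)))]| ≤ (2592 M₆ · 2^{−R})ⁿ` — the collar mechanism of `stub_collar6` run on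
the strong-coupling one-point oscillation (`BoundaryLaw.osc_kerE_plane_le_smallBeta`). [folklore] -/
theorem centredMoments6_le_smallBeta_exp {M : ℝ} (hM : ∀ (q : Fin 4 × Fin 4) (z : Fin 4 → ℤ) (U : LGConfig 4 G), |plane G r q z U| ≤ M) :
    ∃ β₁ : ℝ, 0 < β₁ ∧ ∀ β : ℝ, |β| < β₁ →
      ∀ (L n : ℕ) (q : Fin n → Fin 4 × Fin 4) (x : Fin n → (Fin 4 → ℤ)) (R : ℕ), 1 ≤ R → 4 * R + 8 ≤ L →
        (∀ i j : Fin n, i ≠ j → ∃ k : Fin 4,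
          (2 * (R : ℤ) + 4) ≤ |((((x i k - x j k : ℤ) : ZMod (2 * L + 1))).valMinAbs : ℤ)|) →
        |torusE G r β L (fun U => ∏ i, (plane G r (q i) (x i) U - torusE G r β L (plane G r (q i) (x i))))| ≤
          (2592 * M * (1 / 2 : ℝ) ^ R) ^ n := by
  obtain ⟨β₁, hβ₁, H⟩ := BoundaryLaw.osc_kerE_plane_le_smallBeta G r hM
  refine ⟨β₁, hβ₁, fun β hβ L n q x R hR hRL hsep => ?_⟩
  haveI := r.secondCountableTopology
  haveI := isProbabilityMeasure_wilsonMeasure (d := 4) (L := 2 * L + 1) r.ρ r.continuous β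
  have hM0 : 0 ≤ M := (abs_nonneg _).trans (hM (0, 1) 0 fun _ => 1)
  -- reference exterior and reference values
  set η₀ : LGConfig 4 G := fun _ => 1 with hη₀
  set p : Fin n → ℝ := fun i => kerE G r β (fun k => x i k - (R + 1)) (2 * R + 3) η₀ (plane G r (q i) (x i)) with hp
  have hpM : ∀ i, |p i| ≤ M := fun i => BoundaryLaw.abs_kerE_le G r β _ _ _ (hM (q i) (x i))
  -- the data of the abstract collar bound
  have hmeas : ∀ i : Fin n, Measurable (plane G r (q i) (x i)) := fun i => (continuous_plane r (q i) (x i)).measurable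
  have hAc : ∀ i : Fin n, Continuous fun U => plane G r (q i) (x i) U - p i := fun i =>
    (continuous_plane r (q i) (x i)).sub continuous_const
  have hAb : ∀ (i : Fin n) (U : LGConfig 4 G), |plane G r (q i) (x i) U - p i| ≤ M + M := fun i U =>
    (abs_sub _ _).trans (add_le_add (hM _ _ _) (hpM i))
  have hAS : ∀ i : Fin n, IsCylinder (fun U => plane G r (q i) (x i) U - p i)
      (cubeEdges (fun k => x i k - (R + 1)) (2 * R + 3)) :=
    fun i U V hUV => by simp only [isCylinder_plane_cube r hR (q i) (x i) hUV]
  have hinj : ∀ i : Fin n, Set.InjOn (Torus.proj (2 * L + 1))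
      (((cubeEdges (fun k => x i k - (R + 1)) (2 * R + 3) ∪ cubeEdges (fun k => x i k - (R + 1)) (2 * R + 3) ∪
          (plaquettesTouching (cubeEdges (fun k => x i k - (R + 1)) (2 * R + 3))).biUnion plaquetteEdges).image
          Prod.fst : Set (Fin 4 → ℤ))) := fun i => injOn_torusProj_cube hRL (x i)
  have hfar : ∀ i j : Fin n, i ≠ j → ∀ e ∈ cubeEdges (fun k => x j k - (R + 1)) (2 * R + 3) ∪
      (plaquettesTouching (cubeEdges (fun k => x j k - (R + 1)) (2 * R + 3))).biUnion plaquetteEdges,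
      ∀ e' ∈ cubeEdges (fun k => x i k - (R + 1)) (2 * R + 3),
      torusEdge (2 * L + 1) e ≠ torusEdge (2 * L + 1) e' :=
    fun i j hij e he e' he' => torusEdge_ne_cube (hsep i j hij) he he'
  have hm : ∀ i : Fin n, torusE G r β L (plane G r (q i) (x i)) - p i =
      ∫ W, (plane G r (q i) (x i) (torusLift (2 * L + 1) W) - p i)
        ∂(wilsonMeasure (d := 4) (L := 2 * L + 1) r.ρ β) := fun i =>
    (integral_sub_const_of_abs_le (μ := wilsonMeasure (d := 4) (L := 2 * L + 1) r.ρ β)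
      ((continuous_plane r (q i) (x i)).comp (continuous_torusLift (2 * L + 1))).measurable
      (fun W => hM (q i) (x i) (torusLift (2 * L + 1) W)) (p i)).symm
  -- the strong-coupling one-point law inside each cube: oscillation `≤ 5184 M 2^{-(R+2)} = 1296 M 2^{-R}`
  have hε : ∀ (i : Fin n) (η : LGConfig 4 G),
      |(∫ U, (plane G r (q i) (x i) U - p i) ∂(ymSpecification r.ρ β
        (cubeEdges (fun k => x i k - (R + 1)) (2 * R + 3)) η)) - 0| ≤ 1296 * M * (1 / 2 : ℝ) ^ R := fun i η => by
    haveI := isProbabilityMeasure_ymSpecification r.ρ r.continuous β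
      (cubeEdges (fun k => x i k - (R + 1)) (2 * R + 3)) η
    rw [sub_zero, integral_sub_const_of_abs_le (hmeas i) (fun U => hM (q i) (x i) U) (p i)]
    have hd := depth_centred (x i) R
    have h := H β hβ (q i) (fun k => x i k - (R + 1)) (2 * R + 3) η η₀ (x i)
    rw [hd] at h
    refine h.trans (le_of_eq ?_)
    rw [pow_add]; ring
  have key := abs_integral_prod_sub_mean_le (d := 4) r.ρ r.continuous β (L := 2 * L + 1) (n := n)
      (fun i => cubeEdges (fun k => x i k - (R + 1)) (2 * R + 3))
      (fun i => cubeEdges (fun k => x i k - (R + 1)) (2 * R + 3))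
      (fun i U => plane G r (q i) (x i) U - p i) hAc hAb hAS hinj hfar
      (fun i => torusE G r β L (plane G r (q i) (x i)) - p i) hm hε
  simp only [sub_sub_sub_cancel_right] at key
  refine key.trans (le_of_eq ?_)
  ring

/-- **Centred mixed moments of plane-field strings at strong coupling in the REGISTERED shape `(C/R⁴)ⁿ`** — the body of the
conclusion `MomentBounds6` of the seam's `stub_ceilings` (v4-F), with `β ≥ β₄ ∧ R·u(β) ≤ ℓ₄` replaced by `|β| < β₁(G, r)` and no
femto restriction, for every compact metrisable `G`, every lattice representation and every odd torus; `C = 62208 M₆ / (log 2)⁴`.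
FORMAT RUNG; nothing about `UV`, Bałaban's unit or large `β`. [folklore] -/
theorem centredMoments6_le_smallBeta :
    ∃ β₁ : ℝ, 0 < β₁ ∧ ∃ C : ℝ, 0 ≤ C ∧ ∀ β : ℝ, |β| < β₁ →
      ∀ (L n : ℕ) (q : Fin n → Fin 4 × Fin 4) (x : Fin n → (Fin 4 → ℤ)) (R : ℕ), 1 ≤ R → 4 * R + 8 ≤ L →
        (∀ i j : Fin n, i ≠ j → ∃ k : Fin 4,
          (2 * (R : ℤ) + 4) ≤ |((((x i k - x j k : ℤ) : ZMod (2 * L + 1))).valMinAbs : ℤ)|) →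
        |torusE G r β L (fun U => ∏ i, (plane G r (q i) (x i) U - torusE G r β L (plane G r (q i) (x i))))| ≤
          (C / (R : ℝ) ^ 4) ^ n := by
  obtain ⟨M, hM⟩ := exists_abs_plane_le (G := G) r
  have hM' : ∀ (q : Fin 4 × Fin 4) (z : Fin 4 → ℤ) (U : LGConfig 4 G), |plane G r q z U| ≤ max M 0 := fun q z U =>
    (hM q z U).trans (le_max_left _ _)
  have hM0 : 0 ≤ max M 0 := le_max_right _ _
  obtain ⟨β₁, hβ₁, H⟩ := centredMoments6_le_smallBeta_exp G r hM'
  have hlog : 0 < Real.log 2 := Real.log_pos (by norm_num)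
  refine ⟨β₁, hβ₁, 2592 * max M 0 * (24 / Real.log 2 ^ 4), by positivity, fun β hβ L n q x R hR hRL hsep => ?_⟩
  refine (H β hβ L n q x R hR hRL hsep).trans ?_
  have hbase : 2592 * max M 0 * (1 / 2 : ℝ) ^ R ≤ 2592 * max M 0 * (24 / Real.log 2 ^ 4) / (R : ℝ) ^ 4 :=
    BoundaryLaw.exp_to_quartic (by positivity) hR
  exact pow_le_pow_left₀ (by positivity) hbase n

end Main

end Summit.QuantumFields.YangMills.Cruxes.NT.StrongCoupling

end
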